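import Mathlib
import Summits.Ventures.PercRepro2.SwOutPureJunction

/-!
# Instances of the pure junctions adjacent to `h` (blind cell PercRepro2, night-4 g28,
2026-08-28; proofs/NIGHT4-G28.md §2)

* `ex5` — the smallest connected (graph, marking) pair not settled by the theorems of record
  of the junction lane (g27 §9, uncovered5.txt): `l = 0`, `h = 1`, `o = 2`, the junction `u = 4`
  ADJACENT TO `h`, the edges `l–3, h–4, o–3, o–4, 3–4`; `u`'s other neighbours `o, 3` form the
  pure component `{2, 3}` of `G[U ∖ {h, u}]`.  **`sw_ex5 : Sw ex5 0 1 2`**.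
* `ex9` — TWO junctions adjacent to `h`, `3` and `4`, each with its own pure component
  (`{5, 6}` and `{7, 8}`, every vertex of which is joined to `l`); no theorem of record admits
  two vertices without outside edges in `U ∖ {h, o}`.  **`sw_ex9 : Sw ex9 0 1 2`**.
-/

namespace Summit.Ventures.PercRepro2

namespace LocRows

open Hull

open scoped Classical

/-- The smallest unsettled connected instance: `l = 0`, `h = 1`, `o = 2`, `u = 4`;
edges `l–3, h–4, o–3, o–4, 3–4`. -/
def ex5 : Fin 5 → Sym2 (Fin 5)
  | 0 => s(0, 3) | 1 => s(1, 4) | 2 => s(2, 3) | 3 => s(2, 4) | 4 => s(3, 4)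

/-- **Row (SW) on `ex5`**: the junction `4` is adjacent to `h`; its other neighbours `2, 3` lie
in a component of `G[U ∖ {h, u}]` with no neighbour of `h`. -/
theorem sw_ex5 : Sw ex5 0 1 2 := by
  refine sw_of_pureJunction (l := 0) (h := 1) (o := 2) (u := 4) (by decide) ?_ (by decide)
    (by decide) (by decide) ?_ ?_ ?_
  · intro e; fin_cases e <;> decide
  · intro e e'; fin_cases e <;> fin_cases e' <;> decide
  · intro e x _ hx0 hx1 hx4 q hq e' he'
    have hq' : q ∈ ({0}ᶜ : Set (Fin 5)) \ insert 1 {4} :=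
      compJ_subset_sdiff' (J := {4}) (by simpa using hx0) hx1 (by simpa using hx4) hq
    simp only [Set.mem_sdiff, Set.mem_compl_iff, Set.mem_singleton_iff, Set.mem_insert_iff,
      not_or] at hq'
    fin_cases q
    · exact hq'.1 rfl
    · exact hq'.2.1 rfl
    · fin_cases e' <;> simp [ex5] at he'
    · fin_cases e' <;> simp [ex5] at he'
    · exact hq'.2.2 rfl
  · intro x hx0 hx1 hx2 hx4
    fin_cases x
    · exact absurd rfl hx0
    · exact absurd rfl hx1
    · exact absurd rfl hx2
    · exact ⟨0, by decide⟩
    · exact absurd rfl hx4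

/-- Two junctions adjacent to `h`: `l = 0`, `h = 1`, `o = 2`, the junctions `3` (pure component
`{5, 6}`) and `4` (pure component `{7, 8}`); `5, 6, 7, 8, o` joined to `l`. -/
def ex9 : Fin 13 → Sym2 (Fin 9)
  | 0 => s(1, 3) | 1 => s(1, 4) | 2 => s(3, 5) | 3 => s(3, 6) | 4 => s(5, 6) | 5 => s(5, 0)
  | 6 => s(6, 0) | 7 => s(4, 7) | 8 => s(4, 8) | 9 => s(7, 8) | 10 => s(7, 0) | 11 => s(8, 0)
  | 12 => s(2, 0)

/-- The component of `5` in `G[U ∖ {h, 3, 4}]` is `{5, 6}`. -/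
lemma ex9_compJ_5 : compJ ex9 ({0}ᶜ) 1 {3, 4} 5 ⊆ {5, 6} := by
  refine compJ_subset (by simp) ?_
  intro e x y hexy hx hy
  simp only [Set.mem_insert_iff, Set.mem_singleton_iff] at hx ⊢
  simp only [Set.mem_sdiff, Set.mem_compl_iff, Set.mem_singleton_iff, Set.mem_insert_iff,
    not_or] at hy
  fin_cases e <;> simp only [ex9, Sym2.eq_iff] at hexy <;> omega

/-- The component of `6` in `G[U ∖ {h, 3, 4}]` is `{5, 6}`. -/
lemma ex9_compJ_6 : compJ ex9 ({0}ᶜ) 1 {3, 4} 6 ⊆ {5, 6} := by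
  refine compJ_subset (by simp) ?_
  intro e x y hexy hx hy
  simp only [Set.mem_insert_iff, Set.mem_singleton_iff] at hx ⊢
  simp only [Set.mem_sdiff, Set.mem_compl_iff, Set.mem_singleton_iff, Set.mem_insert_iff,
    not_or] at hy
  fin_cases e <;> simp only [ex9, Sym2.eq_iff] at hexy <;> omega

/-- The component of `7` in `G[U ∖ {h, 3, 4}]` is `{7, 8}`. -/
lemma ex9_compJ_7 : compJ ex9 ({0}ᶜ) 1 {3, 4} 7 ⊆ {7, 8} := by
  refine compJ_subset (by simp) ?_
  intro e x y hexy hx hy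
  simp only [Set.mem_insert_iff, Set.mem_singleton_iff] at hx ⊢
  simp only [Set.mem_sdiff, Set.mem_compl_iff, Set.mem_singleton_iff, Set.mem_insert_iff,
    not_or] at hy
  fin_cases e <;> simp only [ex9, Sym2.eq_iff] at hexy <;> omega

/-- The component of `8` in `G[U ∖ {h, 3, 4}]` is `{7, 8}`. -/
lemma ex9_compJ_8 : compJ ex9 ({0}ᶜ) 1 {3, 4} 8 ⊆ {7, 8} := by
  refine compJ_subset (by simp) ?_
  intro e x y hexy hx hy
  simp only [Set.mem_insert_iff, Set.mem_singleton_iff] at hx ⊢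
  simp only [Set.mem_sdiff, Set.mem_compl_iff, Set.mem_singleton_iff, Set.mem_insert_iff,
    not_or] at hy
  fin_cases e <;> simp only [ex9, Sym2.eq_iff] at hexy <;> omega

/-- The two junctions `3, 4` of `ex9` are pure junctions adjacent to `h` in `{l}ᶜ`. -/
theorem ex9_junctions : PureJunctions ex9 ({0}ᶜ) 1 {3, 4} 2 where
  J_sub := by
    intro u hu
    simp only [Set.mem_insert_iff, Set.mem_singleton_iff] at hu
    rcases hu with rfl | rfl <;> decide
  J_ne_h := by
    intro u hu
    simp only [Set.mem_insert_iff, Set.mem_singleton_iff] at hu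
    rcases hu with rfl | rfl <;> decide
  J_ne_o := by
    intro u hu
    simp only [Set.mem_insert_iff, Set.mem_singleton_iff] at hu
    rcases hu with rfl | rfl <;> decide
  hu_unique := by
    intro u hu e e' he he'
    simp only [Set.mem_insert_iff, Set.mem_singleton_iff] at hu
    rcases hu with rfl | rfl <;> fin_cases e <;> fin_cases e' <;> simp [ex9] at he he' ⊢
  no_JJ := by
    intro u hu u' hu' hne e he
    simp only [Set.mem_insert_iff, Set.mem_singleton_iff] at hu hu'
    rcases hu with rfl | rfl <;> rcases hu' with rfl | rfl <;> fin_cases e <;>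
      simp [ex9] at he hne
  pure := by
    intro u hu e x hex hxU hxh hxJ q hq
    simp only [Set.mem_insert_iff, Set.mem_singleton_iff, not_or] at hu hxJ
    have hx0 : x ≠ 0 := by simpa using hxU
    have hq' : q ∈ ({0}ᶜ : Set (Fin 9)) \ insert 1 {3, 4} :=
      compJ_subset_sdiff' hxU hxh (by simp [hxJ]) hq
    simp only [Set.mem_sdiff, Set.mem_compl_iff, Set.mem_singleton_iff, Set.mem_insert_iff,
      not_or] at hq'
    rcases hu with rfl | rfl
    · -- `u = 3`: `x ∈ {5, 6}`, `q ∈ {5, 6}`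
      have hx : x = 5 ∨ x = 6 := by
        fin_cases e <;> simp only [ex9, Sym2.eq_iff] at hex <;> omega
      have hq56 : q = 5 ∨ q = 6 := by
        rcases hx with rfl | rfl
        · have := ex9_compJ_5 hq; simpa using this
        · have := ex9_compJ_6 hq; simpa using this
      refine ⟨?_, ?_⟩
      · intro e' he'
        rcases hq56 with rfl | rfl <;> fin_cases e' <;> simp [ex9] at he'
      · intro u' hu' hne e' he'
        simp only [Set.mem_insert_iff, Set.mem_singleton_iff] at hu'
        rcases hu' with rfl | rfl
        · exact hne rfl
        · rcases hq56 with rfl | rfl <;> fin_cases e' <;> simp [ex9] at he'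
    · -- `u = 4`: `x ∈ {7, 8}`, `q ∈ {7, 8}`
      have hx : x = 7 ∨ x = 8 := by
        fin_cases e <;> simp only [ex9, Sym2.eq_iff] at hex <;> omega
      have hq78 : q = 7 ∨ q = 8 := by
        rcases hx with rfl | rfl
        · have := ex9_compJ_7 hq; simpa using this
        · have := ex9_compJ_8 hq; simpa using this
      refine ⟨?_, ?_⟩
      · intro e' he'
        rcases hq78 with rfl | rfl <;> fin_cases e' <;> simp [ex9] at he'
      · intro u' hu' hne e' he'
        simp only [Set.mem_insert_iff, Set.mem_singleton_iff] at hu'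
        rcases hu' with rfl | rfl
        · rcases hq78 with rfl | rfl <;> fin_cases e' <;> simp [ex9] at he'
        · exact hne rfl
  hout := by
    intro x hxU hxh hxo hxJ
    simp only [Set.mem_insert_iff, Set.mem_singleton_iff, not_or] at hxJ
    have hx0 : x ≠ 0 := by simpa using hxU
    fin_cases x
    · exact absurd rfl hx0
    · exact absurd rfl hxh
    · exact absurd rfl hxo
    · exact absurd rfl hxJ.1
    · exact absurd rfl hxJ.2
    · exact Or.inl ⟨5, 0, rfl, by simp⟩
    · exact Or.inl ⟨6, 0, rfl, by simp⟩
    · exact Or.inl ⟨10, 0, rfl, by simp⟩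
    · exact Or.inl ⟨11, 0, rfl, by simp⟩

/-- **Row (SW) on `ex9`**: two junctions adjacent to `h` with private pure components. -/
theorem sw_ex9 : Sw ex9 0 1 2 :=
  sw_of_pureJunctions (by decide) (by intro e; fin_cases e <;> decide) ex9_junctions

end LocRows

end Summit.Ventures.PercRepro2
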